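import Summits.ResolutionOfSingularities.ResolutionOfSingularities.Theorems.EquisingularLiftEquisingularLiftNatVertexLineChartA
import Summits.ResolutionOfSingularities.ResolutionOfSingularities.Theorems.EquisingularLiftEquisingularLiftNatVertexLineChartB
import Literature.AlgebraicGeometry.Motives.HypersurfaceChartAlgebra
import HarnessLib

/-!
# [OURS · L1 W4.5(b) · EL♮(3) · nose residue, (c) file 3] LINES THROUGH THE VERTEX IN GENERAL POSITION on the charts of a blowing up of
# the vertex: where a homogeneous form vanishes on the vertex chart `Spec Cᵢ` and on the lifted chart `D₊(xᵢ)`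

Crux chain w45b, child EL♮(3) = stmt-ResolutionOfSingularities-20148; WIDTH seat res-L1-w45b-nose-w3 g3 (D-0157 DOOR 1), brick (c) = the
×3 UNION certificate `DirStepUnobs F₂ univ (⋃ i, vertexLineStrict υ i)` (027's (U1) recipe of record). After a linear change of coordinates
the three Steiner lines are `V₊(F₁, F₂)` for LINEAR FORMS `F₁, F₂` no longer all coordinate hyperplanes; this file extends res-L1-w45b-nose-w3 g2's
chart bookkeeping (✓ `…NatVertexLineChartA/B`, coordinate lines only) to such lines. `--supports stmt-ResolutionOfSingularities-20148 --as helper`.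
OURS; NOT a statement of any manuscript; AI-written, weaker than expert review. No `sorry`; standard axioms; DEF-FREE (the kit's
`attribute [local instance] MvPolynomial.gradedAlgebra` is needed to write `Proj k[x]`). Resolution in char `p` NOT proved here.

WHAT (ANY blowing up `b : P̃ ⟶ ℙ^{d+1}_k` of the vertex `p`; `cᵢ = vertexChart hb i : Spec Cᵢ ⟶ P̃`, `Cᵢ = k[X][I/Xᵢ]`; `F` homogeneous of degree `e > 0`):
* ★ `vertexChart_apply_mem_iff_dehomogenize` — **`F ∈ 𝔭_{b(cᵢ 𝔭)} ↔ F(X₀,…,X_d,1) ∈ 𝔭`** read in `Cᵢ` through `k[X₀,…,X_d] → Cᵢ` (Mathlib/tree: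
  `awayι_preimage_zeroLocus`, `isLocalizationElem_X`, `lastChartEquiv_awayToSection`); `vertexChart_apply_eq_vertex_iff` — `b(cᵢ 𝔭) = p ↔ Xᵢ ∈ 𝔭`.
* `closure_setOf_le_and_notMem_eq_zeroLocus` — for a prime `𝔮 ∌ t`: `closure {𝔮 ≤ 𝔭, t ∉ 𝔭} = V(𝔮)`.
* ★ `preimage_vertexChart_closure_pair` — for forms `F₁, F₂` with `Fⱼ(X,1) = Xᵢ · gⱼ` in `Cᵢ` and `(g₁, g₂)` prime not containing `Xᵢ`:
  **`cᵢ⁻¹ closure (b⁻¹(V₊(F₁,F₂) ∖ {p})) = V(g₁, g₂)`** (the strict transform of the line `V₊(F₁,F₂)` on the chart).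
* `mem_of_mem_preimage_closure_pair` — WITHOUT primality: a point of `cᵢ⁻¹ closure (b⁻¹(V₊(F₁,F₂) ∖ {p}))` contains `g₁, g₂` (used for the
  COVER clause: it forces `X_0/X_i ∉ 𝔭` on the other charts, whence ✓ `vertexChart_mem_opensRange_of_frac_notMem`).
* ★ `preimage_lift_closure_pair` — on the lifted chart `cB : Spec (k[x]_{(x_{i₀'})})₀ ⟶ P̃` of `D₊(x_{i₀'})` (✓ `exists_lift_of_isBlowup_vertex`):
  **`cB⁻¹ closure (b⁻¹(V₊(F₁,F₂) ∖ {p})) = V(F₁(x/x_{i₀'}), F₂(x/x_{i₀'}))`** (`isLocalizationElem_X`: over `D₊(x_{i₀'})` the strict transform IS the total one).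
* `mem_basicOpen_of_mem_pair` — if `X₁,…` force it: a non-vertex point of `V₊(F₁,F₂)` lies in `D₊(x_{i₀'})` (hypothesis form).

References (index only): R. Hartshorne (1977), II §7, II Prop. 2.5 [cite: Hartshorne1977]; The Stacks Project, Tags 0804, 02OS [cite: StacksProject];
A. J. de Jong (1996), proof of Lemma 4.11 [cite: DeJong1996].
-/

set_option linter.dupNamespace false -- mandated namespace `Summit.<Summit>.<Problem>` of this single-conjunct summit

noncomputable section

open CategoryTheory AlgebraicGeometry TopologicalSpace HomogeneousLocalization Topology
open Literature.AlgebraicGeometry.Resolution Literature.AlgebraicGeometry.Resolution.DeJong1996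
open Literature.AlgebraicGeometry.Resolution.PointBlowup (Chart Base frac exc)
open Literature.AlgebraicGeometry.Motives.Segre (grading X_mem chartι)

attribute [local instance] MvPolynomial.gradedAlgebra Literature.AlgebraicGeometry.Motives.ProjBaseChange.algebraBase
  Literature.AlgebraicGeometry.Motives.ProjBaseChange.isScalarTower_localization

namespace Summit.ResolutionOfSingularities.ResolutionOfSingularities.Cruxes.EquisingularLiftNat.Sections

/-! ## A closure lemma in `Spec` -/

/-- **For a prime `𝔮` and `t ∉ 𝔮`: `closure {𝔭 | 𝔮 ≤ 𝔭, t ∉ 𝔭} = V(𝔮)`** (the generic point `𝔮` lies in the set). [folklore] -/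
theorem closure_setOf_le_and_notMem_eq_zeroLocus {R : Type*} [CommRing R] (𝔮 : Ideal R) (h𝔮 : 𝔮.IsPrime) {t : R} (ht : t ∉ 𝔮) :
    closure {𝔭 : PrimeSpectrum R | 𝔮 ≤ 𝔭.asIdeal ∧ t ∉ 𝔭.asIdeal} = PrimeSpectrum.zeroLocus (𝔮 : Set R) := by
  apply le_antisymm
  · exact closure_minimal (fun 𝔭 h𝔭 => h𝔭.1) (PrimeSpectrum.isClosed_zeroLocus _)
  · let q : PrimeSpectrum R := ⟨𝔮, h𝔮⟩
    have hq : q ∈ {𝔭 : PrimeSpectrum R | 𝔮 ≤ 𝔭.asIdeal ∧ t ∉ 𝔭.asIdeal} := ⟨le_rfl, ht⟩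
    calc PrimeSpectrum.zeroLocus (𝔮 : Set R) = closure {q} := (PrimeSpectrum.closure_singleton q).symm
      _ ≤ _ := closure_mono (Set.singleton_subset_iff.mpr hq)

/-! ## Forms on the vertex chart -/

section VertexChart

variable {d : ℕ} {k : Type} [Field k] {P : Scheme.{0}} {b : P ⟶ Proj (grading (Fin (d + 1 + 1)) k)}
  (hb : IsBlowup b (vertexIdealSheaf d k)) (i : Fin (d + 1))

/-- ★ **Where a homogeneous form vanishes on the vertex chart**: for `F` homogeneous of positive degree and a point `𝔭` of `Spec Cᵢ`,
`F ∈ 𝔭_{b(cᵢ 𝔭)} ↔ F(X₀,…,X_d,1) ∈ 𝔭` (the dehomogenisation in `x_{d+1}`, read in `Cᵢ` through `k[X] → Cᵢ`). Generalises ✓ `chartGen_mem_iff`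
(`F = x_j`). [cite: StacksProject, Tag 0804] (OURS bookkeeping) -/
theorem vertexChart_apply_mem_iff_dehomogenize {e : ℕ} (he : 0 < e) {F : MvPolynomial (Fin (d + 1 + 1)) k}
    (hF : F ∈ grading (Fin (d + 1 + 1)) k e) (𝔭 : Spec (.of (Chart d k i))) :
    F ∈ (b (vertexChart hb i 𝔭)).asHomogeneousIdeal ↔
      algebraMap (MvPolynomial (Fin (d + 1)) k) (Chart d k i)
        (Literature.AlgebraicGeometry.Motives.ProjectiveSpace.dehomogenize k (Fin.last (d + 1)) F) ∈ 𝔭.asIdeal := by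
  rw [vertexChart_comp_apply hb i 𝔭]
  have h := Set.ext_iff.mp (Literature.AlgebraicGeometry.Motives.ProjSubscheme.awayι_preimage_zeroLocus (grading (Fin (d + 1 + 1)) k)
    (X_mem k (Fin.last (d + 1))) zero_lt_one hF he)
    (Spec.map (Proj.awayToSection (grading (Fin (d + 1 + 1)) k) (MvPolynomial.X (Fin.last (d + 1))))
      (Spec.map (CommRingCat.ofHom (toChart d k i)) 𝔭))
  rw [Set.mem_preimage] at h
  change ({F} : Set _) ⊆ _ ↔ ({Away.isLocalizationElem (X_mem k (Fin.last (d + 1))) hF} : Set _) ⊆ _ at h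
  rw [Set.singleton_subset_iff, Set.singleton_subset_iff, SetLike.mem_coe, SetLike.mem_coe] at h
  rw [h]
  change toChart d k i ((Proj.awayToSection (grading (Fin (d + 1 + 1)) k) (MvPolynomial.X (Fin.last (d + 1)))).hom
    (Away.isLocalizationElem (X_mem k (Fin.last (d + 1))) hF)) ∈ 𝔭.asIdeal ↔ _
  have hct : ∀ a : MvPolynomial (Fin (d + 1)) k, Literature.AlgebraicGeometry.Motives.ProjectiveSpace.chartAlgEquiv k (Fin.last (d + 1))
      (Literature.AlgebraicGeometry.Motives.ProjectiveSpace.toChart k (Fin.last (d + 1)) a) = a := fun a =>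
    (Literature.AlgebraicGeometry.Motives.ProjectiveSpace.chartAlgEquiv k (Fin.last (d + 1))).apply_symm_apply a
  rw [toChart, RingHom.comp_apply, RingEquiv.toRingHom_eq_coe, RingEquiv.coe_toRingHom, lastChartEquiv_awayToSection,
    Literature.AlgebraicGeometry.Motives.ProjectiveSpace.isLocalizationElem_X, hct]

/-- **`b(cᵢ 𝔭)` is the vertex iff `Xᵢ ∈ 𝔭`** (the vertex is `V₊(x₀,…,x_d)` and `X_j = Xᵢ · X_j/Xᵢ` in `Cᵢ`, `Xᵢ/Xᵢ = 1`). [folklore] -/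
theorem vertexChart_apply_eq_vertex_iff (𝔭 : Spec (.of (Chart d k i))) : b (vertexChart hb i 𝔭) = vertex d k ↔ exc d k i ∈ 𝔭.asIdeal := by
  rw [eq_vertex_iff]
  have hX : ∀ j : Fin (d + 1), (MvPolynomial.X (Fin.castSucc j) : MvPolynomial (Fin (d + 1 + 1)) k) ∈ (b (vertexChart hb i 𝔭)).asHomogeneousIdeal ↔
      exc d k i * frac d k i j ∈ 𝔭.asIdeal := fun j => by
    rw [vertexChart_apply_mem_iff_dehomogenize hb i zero_lt_one (X_mem k (Fin.castSucc j)), ← Fin.succAbove_last,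
      Literature.AlgebraicGeometry.Motives.ProjectiveSpace.dehomogenize_X_succAbove, PointBlowup.algebraMap_X]
  simp only [hX]
  constructor
  · intro h
    simpa [PointBlowup.frac_self] using h i
  · intro h j
    exact Ideal.mul_mem_right _ _ h

/-- ★ **The strict transform of a line `V₊(F₁, F₂)` through the vertex on the vertex chart.** If the forms `F₁, F₂` (positive degrees) read
`Xᵢ · g₁`, `Xᵢ · g₂` in `Cᵢ`, and `(g₁, g₂)` is a prime ideal not containing `Xᵢ`, then `cᵢ⁻¹ closure (b⁻¹(V₊(F₁,F₂) ∖ {p})) = V(g₁, g₂)`.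
[cite: Hartshorne1977, II §7 (strict transform)] (OURS computation) -/
theorem preimage_vertexChart_closure_pair {e₁ e₂ : ℕ} (he₁ : 0 < e₁) (he₂ : 0 < e₂) {F₁ F₂ : MvPolynomial (Fin (d + 1 + 1)) k}
    (hF₁ : F₁ ∈ grading (Fin (d + 1 + 1)) k e₁) (hF₂ : F₂ ∈ grading (Fin (d + 1 + 1)) k e₂) {g₁ g₂ : Chart d k i}
    (hg₁ : algebraMap (MvPolynomial (Fin (d + 1)) k) (Chart d k i)
      (Literature.AlgebraicGeometry.Motives.ProjectiveSpace.dehomogenize k (Fin.last (d + 1)) F₁) = exc d k i * g₁)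
    (hg₂ : algebraMap (MvPolynomial (Fin (d + 1)) k) (Chart d k i)
      (Literature.AlgebraicGeometry.Motives.ProjectiveSpace.dehomogenize k (Fin.last (d + 1)) F₂) = exc d k i * g₂)
    (hprime : (Ideal.span ({g₁, g₂} : Set (Chart d k i))).IsPrime) (hexc : exc d k i ∉ Ideal.span ({g₁, g₂} : Set (Chart d k i))) :
    (vertexChart hb i) ⁻¹' closure (b ⁻¹' ({y : Proj (grading (Fin (d + 1 + 1)) k) |
        F₁ ∈ y.asHomogeneousIdeal ∧ F₂ ∈ y.asHomogeneousIdeal} \ {vertex d k})) =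
      PrimeSpectrum.zeroLocus (Ideal.span ({g₁, g₂} : Set (Chart d k i)) : Set (Chart d k i)) := by
  rw [(vertexChart hb i).isOpenEmbedding.isOpenMap.preimage_closure_eq_closure_preimage (vertexChart hb i).continuous,
    ← closure_setOf_le_and_notMem_eq_zeroLocus _ hprime hexc]
  congr 1
  ext 𝔭
  change (F₁ ∈ (b (vertexChart hb i 𝔭)).asHomogeneousIdeal ∧ F₂ ∈ (b (vertexChart hb i 𝔭)).asHomogeneousIdeal) ∧
      b (vertexChart hb i 𝔭) ∉ ({vertex d k} : Set _) ↔ Ideal.span ({g₁, g₂} : Set (Chart d k i)) ≤ 𝔭.asIdeal ∧ exc d k i ∉ 𝔭.asIdeal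
  rw [Set.mem_singleton_iff, vertexChart_apply_mem_iff_dehomogenize hb i he₁ hF₁, vertexChart_apply_mem_iff_dehomogenize hb i he₂ hF₂,
    hg₁, hg₂, vertexChart_apply_eq_vertex_iff hb i, Ideal.span_le]
  constructor
  · rintro ⟨⟨h₁, h₂⟩, hx⟩
    refine ⟨?_, hx⟩
    rintro g (rfl | rfl)
    · exact ((Ideal.IsPrime.mem_or_mem 𝔭.2 h₁).resolve_left hx)
    · exact ((Ideal.IsPrime.mem_or_mem 𝔭.2 h₂).resolve_left hx)
  · rintro ⟨h, hx⟩
    exact ⟨⟨Ideal.mul_mem_left _ _ (h (Set.mem_insert _ _)), Ideal.mul_mem_left _ _ (h (Set.mem_insert_of_mem _ rfl))⟩, hx⟩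

/-- **Without primality: a point of the vertex chart on the strict transform of `V₊(F₁,F₂)` contains `g₁, g₂`** (the set of points over
`V₊(F₁,F₂) ∖ {p}` lies in the closed `V(g₁, g₂)`). Used for the COVER clause on the other charts. [folklore] -/
theorem mem_of_mem_preimage_closure_pair {e₁ e₂ : ℕ} (he₁ : 0 < e₁) (he₂ : 0 < e₂) {F₁ F₂ : MvPolynomial (Fin (d + 1 + 1)) k}
    (hF₁ : F₁ ∈ grading (Fin (d + 1 + 1)) k e₁) (hF₂ : F₂ ∈ grading (Fin (d + 1 + 1)) k e₂) {g₁ g₂ : Chart d k i}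
    (hg₁ : algebraMap (MvPolynomial (Fin (d + 1)) k) (Chart d k i)
      (Literature.AlgebraicGeometry.Motives.ProjectiveSpace.dehomogenize k (Fin.last (d + 1)) F₁) = exc d k i * g₁)
    (hg₂ : algebraMap (MvPolynomial (Fin (d + 1)) k) (Chart d k i)
      (Literature.AlgebraicGeometry.Motives.ProjectiveSpace.dehomogenize k (Fin.last (d + 1)) F₂) = exc d k i * g₂)
    {𝔭 : Spec (.of (Chart d k i))}
    (h𝔭 : vertexChart hb i 𝔭 ∈ closure (b ⁻¹' ({y : Proj (grading (Fin (d + 1 + 1)) k) |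
        F₁ ∈ y.asHomogeneousIdeal ∧ F₂ ∈ y.asHomogeneousIdeal} \ {vertex d k}))) :
    g₁ ∈ 𝔭.asIdeal ∧ g₂ ∈ 𝔭.asIdeal := by
  have h : 𝔭 ∈ (vertexChart hb i) ⁻¹' closure (b ⁻¹' ({y : Proj (grading (Fin (d + 1 + 1)) k) |
      F₁ ∈ y.asHomogeneousIdeal ∧ F₂ ∈ y.asHomogeneousIdeal} \ {vertex d k})) := h𝔭
  rw [(vertexChart hb i).isOpenEmbedding.isOpenMap.preimage_closure_eq_closure_preimage (vertexChart hb i).continuous] at h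
  have hsub : (vertexChart hb i) ⁻¹' (b ⁻¹' ({y : Proj (grading (Fin (d + 1 + 1)) k) |
      F₁ ∈ y.asHomogeneousIdeal ∧ F₂ ∈ y.asHomogeneousIdeal} \ {vertex d k})) ⊆
      PrimeSpectrum.zeroLocus ({g₁, g₂} : Set (Chart d k i)) := by
    intro 𝔭' h'
    have h'' : (F₁ ∈ (b (vertexChart hb i 𝔭')).asHomogeneousIdeal ∧ F₂ ∈ (b (vertexChart hb i 𝔭')).asHomogeneousIdeal) ∧
        b (vertexChart hb i 𝔭') ∉ ({vertex d k} : Set _) := h'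
    rw [Set.mem_singleton_iff, vertexChart_apply_mem_iff_dehomogenize hb i he₁ hF₁, vertexChart_apply_mem_iff_dehomogenize hb i he₂ hF₂,
      hg₁, hg₂, vertexChart_apply_eq_vertex_iff hb i] at h''
    obtain ⟨⟨h₁, h₂⟩, hx⟩ := h''
    exact (PrimeSpectrum.mem_zeroLocus _ _).mpr (Set.pair_subset_iff.mpr
      ⟨(Ideal.IsPrime.mem_or_mem 𝔭'.2 h₁).resolve_left hx, (Ideal.IsPrime.mem_or_mem 𝔭'.2 h₂).resolve_left hx⟩)
  have hcl : 𝔭 ∈ PrimeSpectrum.zeroLocus ({g₁, g₂} : Set (Chart d k i)) :=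
    closure_minimal hsub (PrimeSpectrum.isClosed_zeroLocus _) h
  exact Set.pair_subset_iff.mp ((PrimeSpectrum.mem_zeroLocus _ _).mp hcl)

end VertexChart

/-! ## Forms on the lifted chart off the vertex -/

section LiftedChart

variable {d : ℕ} {k : Type} [Field k] {P : Scheme.{0}} (b : P ⟶ Proj (grading (Fin (d + 1 + 1)) k)) (i₀ : Fin (d + 1))
  (cB : Spec (.of (Away (grading (Fin (d + 1 + 1)) k) (MvPolynomial.X (Fin.castSucc i₀)))) ⟶ P)
  (hcB : cB ≫ b = chartι k (Fin.castSucc i₀))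

include hcB in
/-- ★ **The strict transform of `V₊(F₁,F₂)` on the lifted chart `D₊(x_{i₀'})`** (over which strict and total transform agree, the vertex not
lying over it): `cB⁻¹ closure (b⁻¹(V₊(F₁,F₂) ∖ {p})) = V(F₁/x_{i₀'}^{e₁}, F₂/x_{i₀'}^{e₂})`. [cite: Hartshorne1977, II §7] (OURS computation) -/
theorem preimage_lift_closure_pair {e₁ e₂ : ℕ} (he₁ : 0 < e₁) (he₂ : 0 < e₂) {F₁ F₂ : MvPolynomial (Fin (d + 1 + 1)) k}
    (hF₁ : F₁ ∈ grading (Fin (d + 1 + 1)) k e₁) (hF₂ : F₂ ∈ grading (Fin (d + 1 + 1)) k e₂) :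
    cB ⁻¹' closure (b ⁻¹' ({y : Proj (grading (Fin (d + 1 + 1)) k) |
        F₁ ∈ y.asHomogeneousIdeal ∧ F₂ ∈ y.asHomogeneousIdeal} \ {vertex d k})) =
      PrimeSpectrum.zeroLocus ({Away.isLocalizationElem (X_mem k (Fin.castSucc i₀)) hF₁,
        Away.isLocalizationElem (X_mem k (Fin.castSucc i₀)) hF₂} : Set _) := by
  have hclosed : IsClosed {y : Proj (grading (Fin (d + 1 + 1)) k) | F₁ ∈ y.asHomogeneousIdeal ∧ F₂ ∈ y.asHomogeneousIdeal} := by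
    have h : {y : Proj (grading (Fin (d + 1 + 1)) k) | F₁ ∈ y.asHomogeneousIdeal ∧ F₂ ∈ y.asHomogeneousIdeal} =
        ((Proj.basicOpen (grading (Fin (d + 1 + 1)) k) F₁ : Set _)ᶜ) ∩ (Proj.basicOpen (grading (Fin (d + 1 + 1)) k) F₂ : Set _)ᶜ := by
      ext y
      simp only [Set.mem_setOf_eq, Set.mem_inter_iff, Set.mem_compl_iff, SetLike.mem_coe, Proj.mem_basicOpen, not_not]
    rw [h]
    exact (Proj.basicOpen _ _).isOpen.isClosed_compl.inter (Proj.basicOpen _ _).isOpen.isClosed_compl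
  -- membership of forms at `chartι w`
  have hmem : ∀ {e : ℕ} (he : 0 < e) {F : MvPolynomial (Fin (d + 1 + 1)) k} (hF : F ∈ grading (Fin (d + 1 + 1)) k e)
      (w : Spec (.of (Away (grading (Fin (d + 1 + 1)) k) (MvPolynomial.X (Fin.castSucc i₀))))),
      F ∈ (chartι k (Fin.castSucc i₀) w).asHomogeneousIdeal ↔ Away.isLocalizationElem (X_mem k (Fin.castSucc i₀)) hF ∈ w.asIdeal := by
    intro e he F hF w
    have h := Set.ext_iff.mp (Literature.AlgebraicGeometry.Motives.ProjSubscheme.awayι_preimage_zeroLocus (grading (Fin (d + 1 + 1)) k)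
      (X_mem k (Fin.castSucc i₀)) zero_lt_one hF he) w
    change ({F} : Set _) ⊆ _ ↔ ({Away.isLocalizationElem (X_mem k (Fin.castSucc i₀)) hF} : Set _) ⊆ _ at h
    rw [Set.singleton_subset_iff, Set.singleton_subset_iff, SetLike.mem_coe, SetLike.mem_coe] at h
    exact h
  ext w
  have key : cB w ∈ closure (b ⁻¹' ({y : Proj (grading (Fin (d + 1 + 1)) k) |
      F₁ ∈ y.asHomogeneousIdeal ∧ F₂ ∈ y.asHomogeneousIdeal} \ {vertex d k})) ↔
      F₁ ∈ (b (cB w)).asHomogeneousIdeal ∧ F₂ ∈ (b (cB w)).asHomogeneousIdeal := by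
    constructor
    · intro h
      have h' : cB w ∈ b ⁻¹' {y : Proj (grading (Fin (d + 1 + 1)) k) | F₁ ∈ y.asHomogeneousIdeal ∧ F₂ ∈ y.asHomogeneousIdeal} :=
        closure_minimal (Set.preimage_mono Set.sdiff_subset) (hclosed.preimage b.continuous) h
      exact h'
    · intro h
      apply subset_closure
      refine ⟨h, ?_⟩
      rw [Set.mem_singleton_iff]
      intro hv
      exact vertex_notMem_basicOpen d k i₀ (hv ▸ lift_apply_mem_preimage i₀ cB hcB w)
  refine key.trans ?_
  rw [lift_comp_apply i₀ cB hcB w, hmem he₁ hF₁ w, hmem he₂ hF₂ w]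
  exact ⟨fun h => (PrimeSpectrum.mem_zeroLocus _ _).mpr (Set.pair_subset_iff.mpr h),
    fun h => Set.pair_subset_iff.mp ((PrimeSpectrum.mem_zeroLocus _ _).mp h)⟩

end LiftedChart

/-! ## Non-vertex points of a line through the vertex lie over the chart `D₊(x_{i₀'})` -/

/-- If `X_{i₀'} ∈ y` together with `F₁, F₂ ∈ y` forces all `x_j ∈ y` (`j ≤ d`), then every point of `V₊(F₁,F₂)` other than the vertex lies in
`D₊(x_{i₀'})`. (Hypothesis form; for Steiner's lines `X₁, X₂ ∈ (F₁, F₂, X₀)`.) [folklore] -/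
theorem mem_basicOpen_of_mem_pair {d : ℕ} {k : Type} [Field k] (i₀ : Fin (d + 1)) {F₁ F₂ : MvPolynomial (Fin (d + 1 + 1)) k}
    (hforce : ∀ y : Proj (grading (Fin (d + 1 + 1)) k), F₁ ∈ y.asHomogeneousIdeal → F₂ ∈ y.asHomogeneousIdeal →
      (MvPolynomial.X (Fin.castSucc i₀) : MvPolynomial (Fin (d + 1 + 1)) k) ∈ y.asHomogeneousIdeal →
        ∀ j : Fin (d + 1), (MvPolynomial.X (Fin.castSucc j) : MvPolynomial (Fin (d + 1 + 1)) k) ∈ y.asHomogeneousIdeal)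
    {y : Proj (grading (Fin (d + 1 + 1)) k)} (h₁ : F₁ ∈ y.asHomogeneousIdeal) (h₂ : F₂ ∈ y.asHomogeneousIdeal) (hy : y ≠ vertex d k) :
    y ∈ Proj.basicOpen (grading (Fin (d + 1 + 1)) k) (MvPolynomial.X (Fin.castSucc i₀)) := by
  rw [Proj.mem_basicOpen]
  intro hX
  exact hy ((eq_vertex_iff d k y).mpr (hforce y h₁ h₂ hX))

end Summit.ResolutionOfSingularities.ResolutionOfSingularities.Cruxes.EquisingularLiftNat.Sections

end
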